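import Mathlib
import Summits.Ventures.HodgeRepro2.T5HoweUniqueness
import Summits.Ventures.HodgeRepro2.T5HoweSmooth

/-!
# The cuspidal reading: `Θ(N)` irreducible ⇒ the partner is `Θ(N)` itself

Blind cell `pub-hodge-repro2`, seat p8 (gen 6), Tier-5 kernel support for the N3 record
(§N3.10.3, the p-adic (D_π) at cuspidal places: MVW chap. 3 IV §9 Corollaire read as
«`ϑ_{m′}(π)` is IRREDUCIBLE, every irreducible partner of `π` is a quotient of it, hence unique»;
CHECK-N3 §7 row N3.10.3).  `T5HoweSmooth` (p393752) took the printed «unique irreducible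
quotient» of `Θ(N) = Hom_R(N, V)` as the hypothesis `∃! J, IsCoatom J`; the cuspidal reading
supplies the stronger printed input «`Θ(N)` is irreducible».  This file records the bridge:

* (`T5HoweUniqueness.existsUnique_isCoatom_of_isSimpleModule`, p391018: a simple module has
  exactly one coatom, `⊥` — so the irreducible reading implies the unique-quotient hypothesis of
  `T5HoweSmooth`; reused, not restated);
* `nonempty_linearEquiv_theta_of_isSimpleModule` — **the partner is `Θ(N)`**: if `Θ(N)` is a
  simple `R₂`-module, every simple `R₂`-module `P` with a non-zero equivariant
  `Φ : V → N ⊗[k] P` is isomorphic to `Θ(N)` (the surjection `t : Θ(N) → P` of `T5HoweSmooth` is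
  an isomorphism, `LinearMap.bijective_of_ne_zero`);
* `nonempty_linearEquiv_of_isSimpleModule_theta` — hence any two partners are isomorphic.

Hypotheses as in `T5HoweSmooth`: `N` simple over `R` with `End_R(N) = k`, `V` semisimple
`N`-isotypic with a commuting `R₂`-action (`V = S[π₁]`).  What stays prose: that MVW's
`ϑ_{m′}(π)` IS `Hom_{G₁}(π, S[π])` (MVW's definition, chap. 2 III.4), the Hecke dictionary, and
the printed irreducibility.  Nothing arithmetic is asserted.

README §8(d): uses an L-value-free non-vanishing device: NO.
-/

namespace Summit.Ventures.HodgeRepro2.T5ThetaIrreducible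

open Summit.Ventures.HodgeRepro2

section Partner

variable {k R R₂ : Type*} [Field k] [Ring R] [Algebra k R] [Ring R₂] [Algebra k R₂]
  {N : Type*} [AddCommGroup N] [Module R N] [Module k N] [IsScalarTower k R N]
  {V : Type*} [AddCommGroup V] [Module R V] [Module k V] [IsScalarTower k R V]
  [Module R₂ V] [SMulCommClass R R₂ V] [SMulCommClass R₂ R V] [IsScalarTower k R₂ V]
  {P : Type*} [AddCommGroup P] [Module R₂ P] [Module k P] [IsScalarTower k R₂ P]

/-- **The partner is `Θ(N)` itself** when `Θ(N) = Hom_R(N, V)` is a simple `R₂`-module. -/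
theorem nonempty_linearEquiv_theta_of_isSimpleModule [IsSimpleModule R N]
    (hSchur : ∀ φ : N →ₗ[R] N, ∃ c : k, ∀ x, φ x = c • x)
    [IsSemisimpleModule R V] (hV : IsIsotypicOfType R V N)
    [IsSimpleModule R₂ (N →ₗ[R] V)] [IsSimpleModule R₂ P]
    (Φ : V →ₗ[R] TensorProduct k N P) (hΦ : Φ ≠ 0)
    (hequiv : ∀ (r : R₂) (x : V),
      Φ (r • x) = TensorProduct.map LinearMap.id (DistribSMul.toLinearMap k P r) (Φ x)) :
    Nonempty ((N →ₗ[R] V) ≃ₗ[R₂] P) := by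
  obtain ⟨t, ht, -⟩ := T5HoweSmooth.exists_surjective_of_equivariant hSchur hV Φ hΦ hequiv
  have hne : t ≠ 0 := by
    intro h0
    have : Nontrivial P := IsSimpleModule.nontrivial R₂ P
    obtain ⟨p, hp⟩ := exists_ne (0 : P)
    obtain ⟨f, hf⟩ := ht p
    apply hp
    rw [← hf, h0]
    rfl
  exact ⟨LinearEquiv.ofBijective t (LinearMap.bijective_of_ne_zero hne)⟩

/-- **Uniqueness of the partner, cuspidal reading**: if `Θ(N)` is simple, any two partners
`P`, `P₂` are isomorphic (both are `≅ Θ(N)`). -/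
theorem nonempty_linearEquiv_of_isSimpleModule_theta [IsSimpleModule R N]
    (hSchur : ∀ φ : N →ₗ[R] N, ∃ c : k, ∀ x, φ x = c • x)
    [IsSemisimpleModule R V] (hV : IsIsotypicOfType R V N)
    [IsSimpleModule R₂ (N →ₗ[R] V)]
    {P₂ : Type*} [AddCommGroup P₂] [Module R₂ P₂] [Module k P₂] [IsScalarTower k R₂ P₂]
    [IsSimpleModule R₂ P] [IsSimpleModule R₂ P₂]
    (Φ₁ : V →ₗ[R] TensorProduct k N P) (hΦ₁ : Φ₁ ≠ 0)
    (hequiv₁ : ∀ (r : R₂) (x : V),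
      Φ₁ (r • x) = TensorProduct.map LinearMap.id (DistribSMul.toLinearMap k P r) (Φ₁ x))
    (Φ₂ : V →ₗ[R] TensorProduct k N P₂) (hΦ₂ : Φ₂ ≠ 0)
    (hequiv₂ : ∀ (r : R₂) (x : V),
      Φ₂ (r • x) = TensorProduct.map LinearMap.id (DistribSMul.toLinearMap k P₂ r) (Φ₂ x)) :
    Nonempty (P ≃ₗ[R₂] P₂) := by
  obtain ⟨e₁⟩ := nonempty_linearEquiv_theta_of_isSimpleModule hSchur hV Φ₁ hΦ₁ hequiv₁
  obtain ⟨e₂⟩ := nonempty_linearEquiv_theta_of_isSimpleModule hSchur hV Φ₂ hΦ₂ hequiv₂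
  exact ⟨e₁.symm.trans e₂⟩

/-- The irreducible reading implies the unique-quotient hypothesis of `T5HoweSmooth`, so its
uniqueness theorem applies verbatim (a second proof of the previous statement). -/
theorem nonempty_linearEquiv_of_isSimpleModule_theta' [IsSimpleModule R N]
    (hSchur : ∀ φ : N →ₗ[R] N, ∃ c : k, ∀ x, φ x = c • x)
    [IsSemisimpleModule R V] (hV : IsIsotypicOfType R V N)
    [IsSimpleModule R₂ (N →ₗ[R] V)]
    {P₂ : Type*} [AddCommGroup P₂] [Module R₂ P₂] [Module k P₂] [IsScalarTower k R₂ P₂]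
    [IsSimpleModule R₂ P] [IsSimpleModule R₂ P₂]
    (Φ₁ : V →ₗ[R] TensorProduct k N P) (hΦ₁ : Φ₁ ≠ 0)
    (hequiv₁ : ∀ (r : R₂) (x : V),
      Φ₁ (r • x) = TensorProduct.map LinearMap.id (DistribSMul.toLinearMap k P r) (Φ₁ x))
    (Φ₂ : V →ₗ[R] TensorProduct k N P₂) (hΦ₂ : Φ₂ ≠ 0)
    (hequiv₂ : ∀ (r : R₂) (x : V),
      Φ₂ (r • x) = TensorProduct.map LinearMap.id (DistribSMul.toLinearMap k P₂ r) (Φ₂ x)) :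
    Nonempty (P ≃ₗ[R₂] P₂) :=
  T5HoweSmooth.nonempty_linearEquiv_of_unique_coatom hSchur hV
    T5HoweUniqueness.existsUnique_isCoatom_of_isSimpleModule Φ₁ hΦ₁ hequiv₁ Φ₂ hΦ₂ hequiv₂

end Partner

end Summit.Ventures.HodgeRepro2.T5ThetaIrreducible
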